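import Summits.ResolutionOfSingularities.ResolutionOfSingularities.Theorems.WeightedInvariantContactCentreFiltration
import Literature.AlgebraicGeometry.Resolution.WeightedInitialForms
import HarnessLib

/-!
# (c11)≤3 for the flat centre filtration `J₃ᵗ = Iota3.jFlatT`, PART 6b-ii/1 — BRIDGES between the contact ladder and the
# Literature's weighted initial forms in dimension three (door `HypersurfaceCentreConstruction`,
# stmt-ResolutionOfSingularities-19897; P3 rung clause (c11)≤3; ORDER (o53) PART 6 = GAP 1′, hand res-L1-w43-stub-3)

Topic: `Summits/ResolutionOfSingularities/ResolutionOfSingularities/Theorems`. Helper for the door item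
`HypersurfaceCentreConstruction` (stmt-ResolutionOfSingularities-19897, route `WeightedInvariant`), line `local-engine`
(L W4.3), def-free.  GAP 1″ (`hcorr` of PART 6a `JFlatEssSmooth.bMax_map_eq_of_corrections`, p547358) is a statement about
the level-`b` FACE of `f`; in dimension three the Literature already provides the graded calculus of the weighted filtration
`F^{(w)}_• = weightedIdealW c w •` of a regular system `c = (y, x₁, x₂)` — `IsInForm` / `inForm` with existence, uniqueness and
multiplicativity (`Literature/AlgebraicGeometry/Resolution/WeightedInitialForms.lean`, Cossart–Jannsen–Saito LNM 2270 §8).  THIS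
FILE connects the two vocabularies:

* §1 `monom3_comp`, **`map_weightedIdealW`** — `(F^{(w)}_ρ(c)) S' = F^{(w)}_ρ(φ ∘ c)` along any ring homomorphism;
  `isWeightedHomogeneous_map`; **`IsInForm.baseChange`** — along a local homomorphism `φ : S → S'` an initial form `P` of
  `f` becomes the initial form `P ⊗ κ(S')` of `φ f` w.r.t. `φ ∘ c` (the face of `f` is the face of `φ f`).
* §2 `pow_maximalIdeal_le_weightedIdealW` (`𝔪^m ⊆ F^{(w)}_m` for positive weights), and
  **`weightedIdealW_eq_contactFiltration`** — for `c = (y, x₁, x₂)` generating `𝔪` and `w = (b, 1, 1)`, `b ≥ 1`: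
  `F^{(w)}_n = contactFiltration y b n` (`= ⨆ j, (y^j) 𝔪^{n - bj}`, res-type-092's p514802), every `n`.  So «`f` reaches
  level `b` via `y`» reads `f ∈ F^{(b,1,1)}_{bν}(y, x₁, x₂)`, and the face of `f` at level `b` is `inForm c (b,1,1) (bν) f`.

[OURS · L1 W4.3 · (o53)]  Replaces the role of NO printed item; NOT a statement of the manuscript
[claim: Hironaka2017, status: under-review]. AI work, weaker than expert review.  Pure commutative algebra; no named facts.

## References

* V. Cossart, U. Jannsen, S. Saito, LNM 2270 (2020), Def. 8.2, Lemma 8.3. [CossartJannsenSaito2020]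
* H. Hironaka, *Characteristic polyhedra of singularities*, J. Math. Kyoto Univ. 7 (1967), §1, §3. [Hironaka1967]
-/

noncomputable section

open IsLocalRing MvPolynomial Literature.AlgebraicGeometry.Resolution
open Summit.ResolutionOfSingularities.ResolutionOfSingularities.Cruxes.HypersurfaceCentreConstruction.LocalEngine

set_option linter.dupNamespace false -- mandated namespace of this single-conjunct summit

namespace Summit.ResolutionOfSingularities.ResolutionOfSingularities.Theorems

namespace JFlatEssSmooth

/-! ## §1 The weighted filtration and initial forms under a ring homomorphism -/

section Map

variable {R T : Type} [CommRing R] [CommRing T]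

/-- `monom3 (φ ∘ c) e = φ (monom3 c e)`. [folklore] -/
theorem monom3_comp (φ : R →+* T) (c : Fin 3 → R) (e : Fin 3 →₀ ℕ) : monom3 (φ ∘ c) e = φ (monom3 c e) := by
  simp [monom3, map_mul, map_pow]

/-- **`(F^{(w)}_ρ(c)) T = F^{(w)}_ρ(φ ∘ c)`**: the weighted order ideal extends generator by generator. [folklore] -/
theorem map_weightedIdealW (φ : R →+* T) (c : Fin 3 → R) (w : Fin 3 → ℕ) (ρ : ℕ) :
    (weightedIdealW c w ρ).map φ = weightedIdealW (φ ∘ c) w ρ := by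
  unfold weightedIdealW
  rw [Ideal.map_span]
  congr 1
  ext m
  constructor
  · rintro ⟨_, ⟨e, he, rfl⟩, rfl⟩
    exact ⟨e, he, (monom3_comp φ c e).symm⟩
  · rintro ⟨e, he, rfl⟩
    exact ⟨monom3 c e, ⟨e, he, rfl⟩, (monom3_comp φ c e).symm⟩

/-- Mapping the coefficients preserves weighted homogeneity. [folklore] -/
theorem isWeightedHomogeneous_map (φ : R →+* T) {w : Fin 3 → ℕ} {n : ℕ} {F : MvPolynomial (Fin 3) R}
    (hF : F.IsWeightedHomogeneous w n) : (MvPolynomial.map φ F).IsWeightedHomogeneous w n := by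
  intro m hm
  rw [coeff_map] at hm
  exact hF fun h => hm (by rw [h, map_zero])

variable [IsLocalRing R] [IsLocalRing T] [Algebra R T] [IsLocalHom (algebraMap R T)]

/-- **INITIAL FORMS BASE-CHANGE**: along a local homomorphism `φ : R → T`, an initial form `P` of `f` in degree `n` w.r.t.
`(c, w)` gives the initial form `P ⊗ κ(T)` of `φ f` w.r.t. `(φ ∘ c, w)` — the face of `f` IS the face of `φ f`.
[cite: CossartJannsenSaito2020, Def. 8.2] -/
theorem IsInForm.baseChange {c : Fin 3 → R} {w : Fin 3 → ℕ} {n : ℕ} {f : R}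
    {P : MvPolynomial (Fin 3) (ResidueField R)} (h : IsInForm c w n f P) :
    IsInForm (algebraMap R T ∘ c) w n (algebraMap R T f)
      (MvPolynomial.map (algebraMap (ResidueField R) (ResidueField T)) P) := by
  obtain ⟨F, hF, rfl, hrem⟩ := h
  refine ⟨MvPolynomial.map (algebraMap R T) F, isWeightedHomogeneous_map _ hF, ?_, ?_⟩
  · rw [MvPolynomial.map_map, MvPolynomial.map_map]
    congr 1
  · have heval : eval (algebraMap R T ∘ c) (MvPolynomial.map (algebraMap R T) F) = algebraMap R T (eval c F) := by
      rw [eval_map, show eval c F = eval₂ (RingHom.id R) c F from rfl, eval₂_comp_left]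
      rfl
    rw [heval, ← map_sub, ← map_weightedIdealW]
    exact Ideal.mem_map_of_mem _ hrem

end Map

/-! ## §2 The `(b, 1, 1)`-filtration of `(y, x₁, x₂)` is the contact filtration of `y` at weight `b` -/

section Contact

variable {S : Type} [CommRing S] [IsLocalRing S]

/-- `𝔪^m ⊆ F^{(w)}_m` for positive weights and `(c) = 𝔪`. [folklore] -/
theorem pow_maximalIdeal_le_weightedIdealW (c : Fin 3 → S) (hgen : Ideal.span (Set.range c) = maximalIdeal S)
    {w : Fin 3 → ℕ} (hw : ∀ i, 0 < w i) (m : ℕ) : maximalIdeal S ^ m ≤ weightedIdealW c w m := by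
  induction m with
  | zero =>
    intro x _
    have h1 : (1 : S) ∈ weightedIdealW c w 0 := by
      have : (1 : S) = monom3 c 0 := by simp [monom3]
      rw [this]
      exact monomial_mem_weightedIdealW c w (by simp)
    simpa using Ideal.mul_mem_left _ x h1
  | succ m ih =>
    rw [pow_succ']
    exact (Ideal.mul_mono_right ih).trans (maximalIdeal_mul_weightedIdealW_le c w hw hgen m)

/-- **`F^{(b,1,1)}_n(y, x₁, x₂) = contactFiltration y b n`** (`= ⨆ j, (y^j) · 𝔪^{n - bj}`) for a system `(y, x₁, x₂)`
generating `𝔪` and `b ≥ 1`: the weighted order ideal of the Literature's initial-form calculus IS the contact filtration of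
res-type-092's centre filtration. [cite: Hironaka1967, §1] -/
theorem weightedIdealW_eq_contactFiltration (y x₁ x₂ : S) (hgen : Ideal.span {y, x₁, x₂} = maximalIdeal S) {b : ℕ}
    (hb : 1 ≤ b) (n : ℕ) : weightedIdealW ![y, x₁, x₂] ![b, 1, 1] n = contactFiltration y b n := by
  have hgenr : Ideal.span (Set.range ![y, x₁, x₂]) = maximalIdeal S :=
    span_range_eq_of_span_triple ![y, x₁, x₂] (by simpa using hgen)
  have hw : ∀ i, 0 < (![b, 1, 1] : Fin 3 → ℕ) i := fun i => by fin_cases i <;> (simp; try omega)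
  have hy : y ∈ maximalIdeal S := hgen ▸ Ideal.subset_span (by simp)
  have hx₁ : x₁ ∈ maximalIdeal S := hgen ▸ Ideal.subset_span (by simp)
  have hx₂ : x₂ ∈ maximalIdeal S := hgen ▸ Ideal.subset_span (by simp)
  rw [contactFiltration_def]
  apply le_antisymm
  · -- every weighted monomial lies in the piece `j = e 0`
    refine Ideal.span_le.mpr ?_
    rintro _ ⟨e, he, rfl⟩
    have hwt : Finsupp.weight ![b, 1, 1] e = b * e 0 + e 1 + e 2 := by
      rw [Finsupp.weight_apply, Finsupp.sum_fintype _ _ (by simp)]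
      simp [Fin.sum_univ_three, mul_comm]
    rw [hwt] at he
    refine Ideal.mem_iSup_of_mem (e 0) ?_
    have hmon : monom3 ![y, x₁, x₂] e = y ^ e 0 * (x₁ ^ e 1 * x₂ ^ e 2) := by
      simp [monom3, mul_assoc]
    rw [hmon]
    refine Ideal.mul_mem_mul (Ideal.mem_span_singleton_self _) ?_
    have hx : x₁ ^ e 1 * x₂ ^ e 2 ∈ maximalIdeal S ^ (e 1 + e 2) := by
      rw [pow_add]
      exact Ideal.mul_mem_mul (Ideal.pow_mem_pow hx₁ _) (Ideal.pow_mem_pow hx₂ _)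
    exact Ideal.pow_le_pow_right (by omega) hx
  · -- every piece `(y^j) 𝔪^{n - bj}` lies in the weighted ideal
    refine iSup_le fun j => ?_
    have hyj : y ^ j ∈ weightedIdealW ![y, x₁, x₂] ![b, 1, 1] (b * j) := by
      have : y ^ j = monom3 ![y, x₁, x₂] (Finsupp.single 0 j) := by simp [monom3]
      rw [this]
      refine monomial_mem_weightedIdealW _ _ ?_
      rw [Finsupp.weight_apply, Finsupp.sum_single_index (by simp)]
      simp [mul_comm]
    calc Ideal.span {y ^ j} * maximalIdeal S ^ (n - b * j)
        ≤ weightedIdealW ![y, x₁, x₂] ![b, 1, 1] (b * j) * weightedIdealW ![y, x₁, x₂] ![b, 1, 1] (n - b * j) :=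
          Ideal.mul_mono ((Ideal.span_singleton_le_iff_mem _).mpr hyj)
            (pow_maximalIdeal_le_weightedIdealW _ hgenr hw _)
      _ ≤ weightedIdealW ![y, x₁, x₂] ![b, 1, 1] (b * j + (n - b * j)) := weightedIdealW_mul_le _ _ _ _
      _ ≤ weightedIdealW ![y, x₁, x₂] ![b, 1, 1] n := weightedIdealW_antitone _ _ (by omega)

/-- **`f` reaches level `b` via `y` iff `f ∈ F^{(b,1,1)}_{bν}(y, x₁, x₂)`** — the dictionary entry used by the face arguments
of GAP 1″. [folklore] -/
theorem mem_weightedIdealW_iff_mem_contactFiltration (y x₁ x₂ : S) (hgen : Ideal.span {y, x₁, x₂} = maximalIdeal S)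
    {b : ℕ} (hb : 1 ≤ b) (n : ℕ) (f : S) :
    f ∈ weightedIdealW ![y, x₁, x₂] ![b, 1, 1] n ↔ f ∈ contactFiltration y b n := by
  rw [weightedIdealW_eq_contactFiltration y x₁ x₂ hgen hb n]

end Contact

end JFlatEssSmooth

end Summit.ResolutionOfSingularities.ResolutionOfSingularities.Theorems

end
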